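import Mathlib
import HarnessLib
import Literature.NumberTheory.LFunctions.RHWave0PNTProofs
import Summits.Parity.GeneralizedHardyLittlewood.Theses.PolynomialKatai
import Summits.Parity.GeneralizedHardyLittlewood.Theorems.PrimeMultiplierChowla.Negative.FalseWithoutShiftNonzero

/-!
# `PrimeMultiplierChowla` is false without the cap `P ≤ X^{1/4}` (negative lemma for stmt-Parity-18777)

Second load-bearing hypothesis of the crux
`Summit.Parity.GeneralizedHardyLittlewood.Theses.PolynomialKatai.PrimeMultiplierChowla` ("the door"
of route PolynomialKatai), companion of `FalseWithoutShiftNonzero.lean` (guard `Δ ≠ 0`). The type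
negated by `primeMultiplierChowla_false_without_cap` is the door verbatim except that the upper
window condition `(P : ℝ) ≤ (X : ℝ) ^ (1 / 4 : ℝ) →` is deleted; it is FALSE.

Witness: `L = 1, ε = 1/100, δ = 1/8, X = P, a = 1, k = 1, Δ = 1, e ≡ 0, lo ≡ hi ≡ 1` with `P`
large: each inner sum is the single term `λ(1)·λ(p+1) = ±1`, so the left side is the number of
primes in `(P, 2P]`, which is `≥ P/(4 log P)` (`pmc_card_primes_Ioc_ge`: prime number theorem
`θ(x) ~ x` from `Literature.NumberTheory.LFunctions.chebyshevTheta_isEquivalent` plus Mathlib's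
`Chebyshev.theta_le_log4_mul_x`), against the right side `P/(100 log P)`.

Reading: some cap `P ≤ X^θ` with `θ < 1` is necessary (single-term witnesses total `π(2P) − π(P)`);
with the route's `θ = 1/4` they total `≤ 2X^{1/4} = o(X / log P)`, so the cap as filed has room to
spare — the planner's remark "the exponent 1/4 is not load-bearing (any fixed θ < 1/2 works)" is
about the transfer; this lemma records the trivial outer limit `θ < 1` of the door itself
(refuter crux-attack at birth, 2026-08-17). [folklore]
-/

namespace Summit.Parity.GeneralizedHardyLittlewood.Theorems.PrimeMultiplierChowlaNegative

open Filter

/-- NEGATIVE LEMMA (load-bearing hypothesis of stmt-Parity-18777): the door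
`PolynomialKatai.PrimeMultiplierChowla` with its cap `P ≤ X^{1/4}` dropped — the negated type below
is the door verbatim except that `(P : ℝ) ≤ (X : ℝ) ^ (1 / 4 : ℝ) →` is deleted — is false: at
`X = P`, `lo = hi = 1`, `Δ = 1` every inner sum is the single term `λ(1)λ(p+1) = ±1`, so the left
side counts the primes in `(P, 2P]`, `≥ P/(4 log P)` of them (PNT), against `P/(100 log P)`.
Some cap `P ≤ X^θ` with `θ < 1` is therefore necessary; the route's `θ = 1/4` has room to spare
(single-term witnesses then total `≤ 2X^{1/4} = o(X / log P)`). [folklore] -/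
theorem primeMultiplierChowla_false_without_cap :
    ¬ (∀ L : ℕ, 1 ≤ L → ∀ ε : ℝ, 0 < ε → ∀ δ : ℝ, 0 < δ → ∃ X₀ : ℕ, ∀ X : ℕ, X₀ ≤ X → ∀ P : ℕ,
      (X : ℝ) ^ δ ≤ (P : ℝ) → ∀ a : ℤ, a ≠ 0 → |a| ≤ (L : ℤ) →
      ∀ k : ℕ, 1 ≤ k → k ≤ L → ∀ Δ : ℤ, Δ ≠ 0 → |Δ| ≤ (L : ℤ) * (X : ℤ) → ∀ e lo hi : ℕ → ℕ,
      (∀ p : ℕ, hi p * P ≤ L * X) →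
      (∑ p ∈ (Finset.Ioc P (2 * P)).filter Nat.Prime,
        |∑ u ∈ (Finset.Icc (lo p) (hi p)).filter (fun u : ℕ => u ≡ e p [MOD k]),
          ((ArithmeticFunction.liouville u : ℤ) : ℝ) *
            ((ArithmeticFunction.liouville (Int.toNat ((a * p * u : ℤ) + Δ)) : ℤ) : ℝ)|) ≤
        ε * (X : ℝ) / Real.log (P : ℝ)) := by
  intro h
  -- PNT: `θ(t) ≥ (19/20) t` for all large `t`
  have hθev : ∀ᶠ t : ℝ in atTop, (1 - 1 / 20) * t ≤ Chebyshev.theta t := by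
    have hb := (Literature.NumberTheory.LFunctions.chebyshevTheta_isEquivalent).isLittleO.bound
      (show (0 : ℝ) < 1 / 20 by norm_num)
    filter_upwards [hb, eventually_ge_atTop 0] with t ht ht0
    simp only [Pi.sub_apply, Real.norm_eq_abs, abs_of_nonneg ht0] at ht
    have := (abs_le.mp ht).1
    linarith
  obtain ⟨T₀, hT₀⟩ := Filter.eventually_atTop.mp hθev
  obtain ⟨X₀, hX₀⟩ := h 1 le_rfl (1 / 100) (by norm_num) (1 / 8) (by norm_num)
  -- the witness scale `X = P ≥ max (X₀, T₀, 16)`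
  obtain ⟨P, hP⟩ : ∃ P : ℕ, max (X₀ : ℝ) (max T₀ 16) ≤ P := exists_nat_ge _
  have hPX₀ : (X₀ : ℝ) ≤ P := le_trans (le_max_left _ _) hP
  have hPT₀ : T₀ ≤ (P : ℝ) := le_trans ((le_max_left _ _).trans (le_max_right _ _)) hP
  have hP16 : (16 : ℝ) ≤ P := le_trans ((le_max_right _ _).trans (le_max_right _ _)) hP
  have hP1 : (1 : ℝ) ≤ P := by linarith
  have hPnat1 : 1 ≤ P := by exact_mod_cast hP1
  have hXX₀ : X₀ ≤ P := by exact_mod_cast hPX₀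
  have hwin1 : ((P : ℕ) : ℝ) ^ (1 / 8 : ℝ) ≤ (P : ℝ) := by
    refine (Real.rpow_le_rpow_of_exponent_le hP1 ?_).trans (le_of_eq (Real.rpow_one _))
    norm_num
  have key := hX₀ P hXX₀ P hwin1 1 one_ne_zero (by simp) 1 le_rfl le_rfl 1 one_ne_zero
    (by rw [abs_one, Nat.cast_one, one_mul]; exact_mod_cast hPnat1)
    (fun _ => 0) (fun _ => 1) (fun _ => 1) (fun p => by show 1 * P ≤ 1 * P; exact le_rfl)
  -- every inner sum is the single term `λ(1)·λ(p+1) = ±1`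
  have hinner : ∀ p ∈ (Finset.Ioc P (2 * P)).filter Nat.Prime,
      |∑ u ∈ (Finset.Icc 1 1).filter (fun u : ℕ => u ≡ 0 [MOD 1]),
        ((ArithmeticFunction.liouville u : ℤ) : ℝ) *
          ((ArithmeticFunction.liouville (Int.toNat (((1 : ℤ) * p * u : ℤ) + 1)) : ℤ) : ℝ)| = 1 := by
    intro p _hp
    rw [Finset.filter_eq_self.mpr (fun u _ => Nat.modEq_one), Finset.Icc_self, Finset.sum_singleton]
    have hcast : (((1 : ℤ) * p * ((1 : ℕ) : ℤ) : ℤ) + 1).toNat = p + 1 := by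
      have : (((1 : ℤ) * p * ((1 : ℕ) : ℤ) : ℤ) + 1) = ((p + 1 : ℕ) : ℤ) := by push_cast; ring
      rw [this, Int.toNat_natCast]
    rw [hcast, ArithmeticFunction.liouville_apply_one,
      ArithmeticFunction.liouville_apply (Nat.succ_ne_zero p)]
    push_cast
    simp
  have hLHS : (((Finset.Ioc P (2 * P)).filter Nat.Prime).card : ℝ) ≤
      1 / 100 * ((P : ℕ) : ℝ) / Real.log (P : ℝ) :=
    calc (((Finset.Ioc P (2 * P)).filter Nat.Prime).card : ℝ)
          = ∑ p ∈ (Finset.Ioc P (2 * P)).filter Nat.Prime, (1 : ℝ) := by simp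
      _ = ∑ p ∈ (Finset.Ioc P (2 * P)).filter Nat.Prime,
            |∑ u ∈ (Finset.Icc 1 1).filter (fun u : ℕ => u ≡ 0 [MOD 1]),
              ((ArithmeticFunction.liouville u : ℤ) : ℝ) *
                ((ArithmeticFunction.liouville (Int.toNat (((1 : ℤ) * p * u : ℤ) + 1)) : ℤ) : ℝ)| :=
            (Finset.sum_congr rfl hinner).symm
      _ ≤ 1 / 100 * ((P : ℕ) : ℝ) / Real.log (P : ℝ) := key
  -- compare with the dyadic prime count
  have hlogpos : 0 < Real.log (P : ℝ) := Real.log_pos (by linarith)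
  have hcard := pmc_card_primes_Ioc_ge hT₀ hPT₀ hP16
  have h2 : (((Finset.Ioc P (2 * P)).filter Nat.Prime).card : ℝ) * Real.log P ≤ (P : ℝ) / 100 := by
    have h := hLHS
    rw [le_div_iff₀ hlogpos] at h
    linarith
  have hcard0 : (0 : ℝ) ≤ (((Finset.Ioc P (2 * P)).filter Nat.Prime).card : ℝ) := Nat.cast_nonneg _
  nlinarith [hcard, h2, hcard0, hlogpos]

end Summit.Parity.GeneralizedHardyLittlewood.Theorems.PrimeMultiplierChowlaNegative
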